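import Summits.ValiantsHypothesis.ValiantsHypothesis.Theorems.DualUnipotentThreeHalves.Negative.HeavyTopInstThreeFive

/-!
# `GrenetZeon.DualUnipotentThreeHalves` (stmt-ValiantsHypothesis-24318) — line «radical_split» §8, instance table of R2:
# TOOLKIT — coordinate subspaces, dead coordinates, products and split quadrics vanishing on a subspace

24318 `HeavyTopLaw` INSTRUMENT (director-valiant g13 R259 (a) / R263; the cut named by the instrument pen val-port-3 g2, 15:14Z:
«the (4,7) far-corner NEGATIVE certificate on the ✓ p635270 template — word certificates of length ≤ 3»; this file val-port-2 g2,
val-lit merged desk b71 (B) port pool).  Part of the chain `…GrenetZeonDualUnipotentThreeHalvesHeavyTopInstFourSeven{Defs, Toolkit, Blocks, BudgetOne}` (flat helper files) →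
`…DualUnipotentThreeHalves/Negative/HeavyTopInstFourSeven` (`¬ HeavyTopInst 4 7`, Negative lane).

Generic linear algebra over `ℂ` for coordinate spaces `ι → ℂ` (no reference to the pencil):
* `finrank_le_of_forall_apply_eq_zero`, `finrank_add_length_le_of_forall_apply_eq_zero` — dead coordinates bound the dimension;
  `exists_deadSubmodule`, `mem_of_forall_apply_eq_zero_of_le` — SATURATION: with `dim K + #dead ≥ #ι` the subspace IS the
  coordinate subspace (membership test).
* `forall_or_forall_of_forall_or` (logic), `mul_single_mul_apply` (`(Q·E_{ab}·Q)_{ij} = Q_{ia} Q_{bj}` for `7 × 7` matrices).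
* `forall_mul_eq_zero_of_mul3`, `forall_apply_eq_zero_or₃` — a product of THREE coordinates vanishing on a subspace kills one of
  them (evaluate on `v + t u`, `t = 1, −1, 2`); `forall_apply_eq_zero_or_quad` — a coordinate times a two-term quadric likewise.
* `finrank_le_two_of_isotropic` — a totally isotropic subspace of the split quadric `y₀y₁ + y₂y₃` on `ℂ⁴` has dimension `≤ 2`
  (elementary polarisation); `finrank_le_of_isotropic` — hence a subspace of `ι → ℂ` on which `v_b v_c + v_d v_e ≡ 0` and which
  vanishes on a further list `l` has `dim + #l + 2 ≤ #ι`.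

Honest framing.  Helper lemmas for ONE tiny format of R2's instance table (`--supports stmt-ValiantsHypothesis-24318 --as helper`);
nothing here asserts or refutes R2 `HeavyTopLaw` (take `n₀ ≥ 5` or `C₀ ≥ 2` and `(4,7)` is discarded), S3b, the crux
`DualUnipotentThreeHalves`, rung 8062 or `VP ≠ VNP` — all OPEN / NOT proved.
[this line's workfile §8; port-3 g2 `Cruxes/DualUnipotentThreeHalves/INSTANCES.md` v1 (5); ✓ `…Negative.HeavyTopInstThreeFive`; ✓ `…WordFlagPencil`]
-/

-- `Summit.ValiantsHypothesis.ValiantsHypothesis.…` repeats a component (D-0017 layout); `dupNamespace` would flag the mandated name.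
set_option linter.dupNamespace false
set_option autoImplicit false

noncomputable section

namespace Summit.ValiantsHypothesis.ValiantsHypothesis.Theorems.GrenetZeon.RadicalSplit

open MvPolynomial Matrix
open scoped BigOperators
open Summit.ValiantsHypothesis.ValiantsHypothesis.Cruxes.TwoDimCoefficients.DimTwoCases (AffMat IsAffine)

/-- If every vector of `K` vanishes on the coordinates in `D`, then `dim K ≤ #ι − #D`. -/
theorem finrank_le_of_forall_apply_eq_zero {ι : Type*} [Fintype ι] [DecidableEq ι] (K : Submodule ℂ (ι → ℂ))
    (D : Finset ι) (hD : ∀ v ∈ K, ∀ c ∈ D, v c = 0) :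
    Module.finrank ℂ K ≤ Fintype.card ι - D.card := by
  classical
  let A := {c : ι // c ∉ D}
  let f : K →ₗ[ℂ] (A → ℂ) := (LinearMap.funLeft ℂ ℂ (Subtype.val : A → ι)).comp K.subtype
  have hf : Function.Injective f := by
    intro u w huw
    apply Subtype.ext
    funext c
    by_cases hc : c ∈ D
    · rw [hD u u.2 c hc, hD w w.2 c hc]
    · have := congr_fun huw ⟨c, hc⟩
      simpa [f] using this
  have h1 := LinearMap.finrank_le_finrank_of_injective hf
  have h2 : Module.finrank ℂ (A → ℂ) = Fintype.card A := Module.finrank_fintype_fun_eq_card ℂ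
  have h3 : Fintype.card A = Fintype.card ι - D.card := by
    rw [Fintype.card_subtype_compl, Fintype.card_coe]
  omega

/-- Dead coordinates bound the dimension (list form, for explicit leaves). -/
theorem finrank_add_length_le_of_forall_apply_eq_zero {ι : Type*} [Fintype ι] [DecidableEq ι] (K : Submodule ℂ (ι → ℂ))
    (l : List ι) (hl : l.Nodup) (hD : ∀ v ∈ K, ∀ c ∈ l, v c = 0) :
    Module.finrank ℂ K + l.length ≤ Fintype.card ι := by
  classical
  have h1 := finrank_le_of_forall_apply_eq_zero K l.toFinset (fun v hv c hc => hD v hv c (List.mem_toFinset.1 hc))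
  rw [List.toFinset_card_of_nodup hl] at h1
  have h2 : l.toFinset.card ≤ Fintype.card ι := Finset.card_le_univ _
  rw [List.toFinset_card_of_nodup hl] at h2
  omega

/-- The coordinate subspace cut out by a list of vanishing coordinates. -/
theorem exists_deadSubmodule {ι : Type*} (l : List ι) :
    ∃ W : Submodule ℂ (ι → ℂ), ∀ v, v ∈ W ↔ ∀ c ∈ l, v c = 0 :=
  ⟨{ carrier := {v | ∀ c ∈ l, v c = 0}
     add_mem' := fun {u w} hu hw c hc => by
       simp only [Set.mem_setOf_eq] at hu hw
       simp [Pi.add_apply, hu c hc, hw c hc]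
     zero_mem' := fun c _ => rfl
     smul_mem' := fun a u hu c hc => by
       simp only [Set.mem_setOf_eq] at hu
       simp [Pi.smul_apply, hu c hc] }, fun _ => Iff.rfl⟩

/-- **Saturation.**  If the vectors of `K` vanish on the coordinates in `l` and `dim K + #l ≥ #ι`, then every vector vanishing
on `l` belongs to `K` (`K` is the whole coordinate subspace). -/
theorem mem_of_forall_apply_eq_zero_of_le {ι : Type*} [Fintype ι] [DecidableEq ι] (K : Submodule ℂ (ι → ℂ))
    (l : List ι) (hl : l.Nodup) (hD : ∀ v ∈ K, ∀ c ∈ l, v c = 0)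
    (hdim : Fintype.card ι ≤ Module.finrank ℂ K + l.length) (u : ι → ℂ) (hu : ∀ c ∈ l, u c = 0) : u ∈ K := by
  classical
  obtain ⟨W, hW⟩ := exists_deadSubmodule (ι := ι) l
  have hKW : K ≤ W := fun v hv => (hW v).2 (hD v hv)
  have hWdim := finrank_add_length_le_of_forall_apply_eq_zero W l hl (fun v hv => (hW v).1 hv)
  have hKeq : K = W := Submodule.eq_of_le_of_finrank_le hKW (by omega)
  rw [hKeq]
  exact (hW u).2 hu

/-- From `∀ a b, P a ∨ Q b` to `(∀ a, P a) ∨ (∀ b, Q b)`. -/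
theorem forall_or_forall_of_forall_or {α β : Type*} {P : α → Prop} {Q : β → Prop}
    (h : ∀ a b, P a ∨ Q b) : (∀ a, P a) ∨ (∀ b, Q b) := by
  by_cases hP : ∀ a, P a
  · exact Or.inl hP
  · push Not at hP
    obtain ⟨a, ha⟩ := hP
    exact Or.inr fun b => (h a b).resolve_left ha

/-- Entry `(i,j)` of `Q · E · Q` where `E` has a single nonzero entry `1` at `(a,b)`. -/
theorem mul_single_mul_apply (Q : Matrix (Fin 7) (Fin 7) ℂ) (a b i j : Fin 7) :
    (Q * Matrix.single a b (1 : ℂ) * Q) i j = Q i a * Q b j := by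
  rw [Matrix.mul_apply, Finset.sum_eq_single b]
  · rw [Matrix.mul_apply, Finset.sum_eq_single a]
    · simp
    · intro k _ hk; simp [Matrix.single_apply_of_ne, Ne.symm hk]
    · simp
  · intro k _ hk
    rw [Matrix.mul_apply, Finset.sum_eq_zero, zero_mul]
    intro l _
    simp [Matrix.single, Ne.symm hk]
  · simp

/-- A product of THREE coordinates vanishing on a subspace: if the first is not identically zero, the product of the other two
vanishes identically (evaluate on `v + t·u`, `t = 1, −1, 2`). -/
theorem forall_mul_eq_zero_of_mul3 {ι : Type*} (K : Submodule ℂ (ι → ℂ)) (a b c : ι)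
    (h : ∀ v ∈ K, v a * v b * v c = 0) (u : ι → ℂ) (hu : u ∈ K) (hua : u a ≠ 0) :
    ∀ v ∈ K, v b * v c = 0 := by
  intro v hv
  by_contra hbc
  have hva : v a = 0 := by
    have h0 : v a * (v b * v c) = 0 := by rw [← mul_assoc]; exact h v hv
    exact (mul_eq_zero.1 h0).resolve_right hbc
  have key : ∀ t : ℂ, t ≠ 0 → (v b + t * u b) * (v c + t * u c) = 0 := by
    intro t ht
    have h1 := h (v + t • u) (K.add_mem hv (K.smul_mem t hu))
    simp only [Pi.add_apply, Pi.smul_apply, smul_eq_mul, hva, zero_add] at h1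
    have h2 : (t * u a) * ((v b + t * u b) * (v c + t * u c)) = 0 := by linear_combination h1
    exact (mul_eq_zero.1 h2).resolve_left (mul_ne_zero ht hua)
  have e1 := key 1 one_ne_zero
  have e2 := key (-1) (by norm_num)
  have e3 := key 2 (by norm_num)
  apply hbc
  linear_combination (3 * e1 + e2 - e3) / 3

/-- A product of three coordinates vanishing on a subspace forces one coordinate to vanish identically. -/
theorem forall_apply_eq_zero_or₃ {ι : Type*} (K : Submodule ℂ (ι → ℂ)) (a b c : ι)
    (h : ∀ v ∈ K, v a * v b * v c = 0) :
    (∀ v ∈ K, v a = 0) ∨ (∀ v ∈ K, v b = 0) ∨ (∀ v ∈ K, v c = 0) := by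
  by_cases ha : ∀ v ∈ K, v a = 0
  · exact Or.inl ha
  · push Not at ha
    obtain ⟨u, hu, hua⟩ := ha
    exact Or.inr (forall_apply_eq_zero_or K b c (forall_mul_eq_zero_of_mul3 K a b c h u hu hua))

/-- A coordinate times a two-term quadric vanishing on a subspace: the coordinate or the quadric vanishes identically
(evaluate on `v + t·u`, `t = 1, −1, 2`). -/
theorem forall_apply_eq_zero_or_quad {ι : Type*} (K : Submodule ℂ (ι → ℂ)) (a b c d e : ι)
    (h : ∀ v ∈ K, v a * (v b * v c + v d * v e) = 0) :
    (∀ v ∈ K, v a = 0) ∨ (∀ v ∈ K, v b * v c + v d * v e = 0) := by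
  by_cases ha : ∀ v ∈ K, v a = 0
  · exact Or.inl ha
  · push Not at ha
    obtain ⟨u, hu, hua⟩ := ha
    refine Or.inr fun v hv => ?_
    by_contra hq
    have hva : v a = 0 := (mul_eq_zero.1 (h v hv)).resolve_right hq
    have key : ∀ t : ℂ, t ≠ 0 →
        (v b + t * u b) * (v c + t * u c) + (v d + t * u d) * (v e + t * u e) = 0 := by
      intro t ht
      have h1 := h (v + t • u) (K.add_mem hv (K.smul_mem t hu))
      simp only [Pi.add_apply, Pi.smul_apply, smul_eq_mul, hva, zero_add] at h1
      exact (mul_eq_zero.1 h1).resolve_left (mul_ne_zero ht hua)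
    have e1 := key 1 one_ne_zero
    have e2 := key (-1) (by norm_num)
    have e3 := key 2 (by norm_num)
    apply hq
    linear_combination (3 * e1 + e2 - e3) / 3

/-- A totally isotropic subspace of the split quadric `y₀y₁ + y₂y₃` on `ℂ⁴` has dimension `≤ 2`
(elementary: a vector of the subspace supported on `{0,1}` kills, by polarisation, one of the coordinates `0, 1` on the whole
subspace; likewise for `{2,3}`). -/
theorem finrank_le_two_of_isotropic (I : Submodule ℂ (Fin 4 → ℂ)) (hI : ∀ y ∈ I, y 0 * y 1 + y 2 * y 3 = 0) :
    Module.finrank ℂ I ≤ 2 := by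
  classical
  by_contra hlt
  push Not at hlt
  have hpol : ∀ y ∈ I, ∀ z ∈ I, y 0 * z 1 + z 0 * y 1 + y 2 * z 3 + z 2 * y 3 = 0 := by
    intro y hy z hz
    have h1 := hI (y + z) (I.add_mem hy hz)
    simp only [Pi.add_apply] at h1
    linear_combination h1 - hI y hy - hI z hz
  -- a nonzero vector of I vanishing on two prescribed coordinates p, q
  have hex : ∀ p q : Fin 4, ∃ u ∈ I, u p = 0 ∧ u q = 0 ∧ u ≠ 0 := by
    intro p q
    let φ : (Fin 4 → ℂ) →ₗ[ℂ] (Fin 2 → ℂ) := LinearMap.pi fun t => LinearMap.proj (![p, q] t)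
    have hrk := LinearMap.finrank_range_add_finrank_ker (φ.domRestrict I)
    have hr : Module.finrank ℂ (LinearMap.range (φ.domRestrict I)) ≤ 2 := by
      have := Submodule.finrank_le (LinearMap.range (φ.domRestrict I))
      simpa [Module.finrank_fintype_fun_eq_card] using this
    have hker : LinearMap.ker (φ.domRestrict I) ≠ ⊥ := by
      intro hbot
      rw [hbot, finrank_bot] at hrk
      omega
    obtain ⟨⟨u, huI⟩, hu0, hune⟩ := (Submodule.ne_bot_iff _).1 hker
    refine ⟨u, huI, ?_, ?_, fun hu => hune (Subtype.ext hu)⟩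
    · simpa [φ] using congr_fun (LinearMap.mem_ker.1 hu0) 0
    · simpa [φ] using congr_fun (LinearMap.mem_ker.1 hu0) 1
  -- one of the coordinates 0, 1 dies on I
  have h01 : (∀ y ∈ I, y 0 = 0) ∨ (∀ y ∈ I, y 1 = 0) := by
    obtain ⟨u, huI, hu2, hu3, hune⟩ := hex 2 3
    have h01u : u 0 * u 1 = 0 := by simpa [hu2, hu3] using hI u huI
    by_cases hu0 : u 0 = 0
    · have hu1 : u 1 ≠ 0 := by
        intro hu1; apply hune; funext t; fin_cases t <;> assumption
      left
      intro y hy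
      have hp := hpol y hy u huI
      rw [hu0, hu2, hu3] at hp
      have : y 0 * u 1 = 0 := by linear_combination hp
      exact (mul_eq_zero.1 this).resolve_right hu1
    · right
      intro y hy
      have hu1 : u 1 = 0 := (mul_eq_zero.1 h01u).resolve_left hu0
      have hp := hpol y hy u huI
      rw [hu1, hu2, hu3] at hp
      have : u 0 * y 1 = 0 := by linear_combination hp
      exact (mul_eq_zero.1 this).resolve_left hu0
  -- one of the coordinates 2, 3 dies on I
  have h23 : (∀ y ∈ I, y 2 = 0) ∨ (∀ y ∈ I, y 3 = 0) := by
    obtain ⟨u, huI, hu0, hu1, hune⟩ := hex 0 1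
    have h23u : u 2 * u 3 = 0 := by simpa [hu0, hu1] using hI u huI
    by_cases hu2 : u 2 = 0
    · have hu3 : u 3 ≠ 0 := by
        intro hu3; apply hune; funext t; fin_cases t <;> assumption
      left
      intro y hy
      have hp := hpol y hy u huI
      rw [hu0, hu1, hu2] at hp
      have : y 2 * u 3 = 0 := by linear_combination hp
      exact (mul_eq_zero.1 this).resolve_right hu3
    · right
      intro y hy
      have hu3 : u 3 = 0 := (mul_eq_zero.1 h23u).resolve_left hu2
      have hp := hpol y hy u huI
      rw [hu0, hu1, hu3] at hp
      have : u 2 * y 3 = 0 := by linear_combination hp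
      exact (mul_eq_zero.1 this).resolve_left hu2
  -- two dead coordinates out of four
  have hfin : ∀ p q : Fin 4, p ≠ q → (∀ y ∈ I, y p = 0) → (∀ y ∈ I, y q = 0) → False := by
    intro p q hpq hp hq
    have := finrank_add_length_le_of_forall_apply_eq_zero I [p, q] (by simp [hpq]) (by
      intro y hy c hc
      simp only [List.mem_cons, List.mem_nil_iff, or_false] at hc
      rcases hc with rfl | rfl
      · exact hp y hy
      · exact hq y hy)
    simp at this
    omega
  rcases h01 with h0 | h1 <;> rcases h23 with h2 | h3
  · exact hfin 0 2 (by decide) h0 h2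
  · exact hfin 0 3 (by decide) h0 h3
  · exact hfin 1 2 (by decide) h1 h2
  · exact hfin 1 3 (by decide) h1 h3

/-- **Isotropy bound.**  If the split quadric `v b · v c + v d · v e` (four distinct coordinates) vanishes on `K` and the vectors
of `K` vanish on a further list `l` of coordinates avoiding `b, c, d, e`, then `dim K + #l + 2 ≤ #ι`. -/
theorem finrank_le_of_isotropic {ι : Type*} [Fintype ι] [DecidableEq ι] (K : Submodule ℂ (ι → ℂ)) (b c d e : ι)
    (l : List ι) (hl : (b :: c :: d :: e :: l).Nodup)
    (hq : ∀ v ∈ K, v b * v c + v d * v e = 0) (hD : ∀ v ∈ K, ∀ x ∈ l, v x = 0) :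
    Module.finrank ℂ K + l.length + 2 ≤ Fintype.card ι := by
  classical
  let χ : (ι → ℂ) →ₗ[ℂ] (Fin 4 → ℂ) := LinearMap.pi fun t => LinearMap.proj (![b, c, d, e] t)
  have hrk := LinearMap.finrank_range_add_finrank_ker (χ.domRestrict K)
  -- the image is totally isotropic
  have hI : ∀ y ∈ LinearMap.range (χ.domRestrict K), y 0 * y 1 + y 2 * y 3 = 0 := by
    rintro y ⟨⟨v, hv⟩, rfl⟩
    simpa [χ] using hq v hv
  have h2 := finrank_le_two_of_isotropic _ hI
  -- the kernel vanishes on b, c, d, e and on l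
  set J := (LinearMap.ker (χ.domRestrict K)).map K.subtype with hJ
  have hJdim : Module.finrank ℂ J = Module.finrank ℂ (LinearMap.ker (χ.domRestrict K)) :=
    Submodule.finrank_map_subtype_eq _ _
  have hJD : ∀ v ∈ J, ∀ x ∈ (b :: c :: d :: e :: l), v x = 0 := by
    intro v hv x hx
    rw [hJ, Submodule.mem_map] at hv
    obtain ⟨⟨w, hwK⟩, hw0, rfl⟩ := hv
    have hz := LinearMap.mem_ker.1 hw0
    simp only [List.mem_cons] at hx
    rcases hx with rfl | rfl | rfl | rfl | hx
    · simpa [χ] using congr_fun hz 0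
    · simpa [χ] using congr_fun hz 1
    · simpa [χ] using congr_fun hz 2
    · simpa [χ] using congr_fun hz 3
    · exact hD w hwK x hx
  have hJle := finrank_add_length_le_of_forall_apply_eq_zero J _ hl hJD
  simp only [List.length_cons] at hJle
  omega

end Summit.ValiantsHypothesis.ValiantsHypothesis.Theorems.GrenetZeon.RadicalSplit

end
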